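import Mathlib.MeasureTheory.Function.Jacobian
import Mathlib.LinearAlgebra.Matrix.ToLin
import Mathlib.Topology.Algebra.Module.FiniteDimension
import Summits.KontsevichZagierPeriods.KontsevichZagierPeriods.Theorems.SoloInformedTameMapDiff
import Summits.KontsevichZagierPeriods.KontsevichZagierPeriods.Theorems.SoloInformedTameEquidecompVolume
import HarnessLib

/-!
# SoloInformed — a valid nonlinear tame dissection computes the volume of its source

Solo programme `solo-KontsevichZagierPeriods-informed`, session s138, third file of the NONLINEAR
form of COROLLARY SQ.  SOUNDNESS of the validity condition of `SoloInformedTameMapDiff`: if the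
real parameter `p` is valid for the nonlinear shape `σ` and the source `D₀`, then

  `vol D₀ = Σ_i vol(piece_i) = Σ_i vol(g_i '' piece_i) = vol(∏_j [0, a_j(p)]) = ∏_j a_j(p)`,

where `g_i` is the moving map read off the `i`-th graph.  The middle step is the change of
variables formula for injective maps differentiable WITHIN a measurable set
(`MeasureTheory.lintegral_abs_det_fderiv_eq_addHaar_image`): the differentiability clause gives
`HasFDerivWithinAt g_i (L_x) piece_i x` with `|det L_x| = 1` at every point of the piece, so
`vol(g_i '' piece_i) = ∫_{piece_i} |det| = vol(piece_i)`.  No interior, openness or finiteness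
hypothesis is needed.

* `soloInformed_hasFDerivWithinAt_of_taylor` — the coordinatewise Taylor clause gives a
  derivative within the set (sup norm on `ℝⁿ`);
* `SoloInformedTameMapShape.volume_image_move_piece` — `vol(g_i '' piece_i) = vol(piece_i)`;
* `SoloInformedTameMapShape.aeval_prod_side_eq_volume_of_valid` — **soundness**.

References: Bochnak–Coste–Roy (1998) §2.2; Evans–Gariepy (1992) §3.3 (area formula).
-/

noncomputable section

namespace Summit.KontsevichZagierPeriods.KontsevichZagierPeriods.Theorems

open Set MvPolynomial MeasureTheory Filter Topology Literature.ModelTheory.ExponentialFields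
open Literature.NumberTheory.Transcendental

section Calculus

variable {n : ℕ}

/-- A squared coordinate is at most the squared sup norm. [folklore] -/
theorem soloInformed_sq_apply_le_norm_sq (v : Fin n → ℝ) (k : Fin n) : v k ^ 2 ≤ ‖v‖ ^ 2 := by
  have h1 : |v k| ≤ ‖v‖ := by simpa only [Real.norm_eq_abs] using norm_le_pi_norm v k
  rw [← sq_abs]
  exact pow_le_pow_left₀ (abs_nonneg _) h1 2

/-- `Σ_k v_k² ≤ n ‖v‖²` for the sup norm. [folklore] -/
theorem soloInformed_sum_sq_le (v : Fin n → ℝ) : ∑ k, v k ^ 2 ≤ n * ‖v‖ ^ 2 := by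
  calc ∑ k, v k ^ 2 ≤ ∑ _k : Fin n, ‖v‖ ^ 2 :=
        Finset.sum_le_sum fun k _ => soloInformed_sq_apply_le_norm_sq v k
    _ = n * ‖v‖ ^ 2 := by simp

/-- `‖v‖² ≤ Σ_k v_k²` for the sup norm. [folklore] -/
theorem soloInformed_norm_sq_le_sum_sq (v : Fin n → ℝ) : ‖v‖ ^ 2 ≤ ∑ k, v k ^ 2 := by
  have h : ‖v‖ ≤ Real.sqrt (∑ k, v k ^ 2) := by
    refine (pi_norm_le_iff_of_nonneg (Real.sqrt_nonneg _)).2 fun k => ?_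
    rw [Real.norm_eq_abs]
    exact Real.abs_le_sqrt
      (Finset.single_le_sum (fun k _ => sq_nonneg (v k)) (Finset.mem_univ k))
  calc ‖v‖ ^ 2 ≤ Real.sqrt (∑ k, v k ^ 2) ^ 2 := pow_le_pow_left₀ (norm_nonneg _) h 2
    _ = ∑ k, v k ^ 2 := Real.sq_sqrt (Finset.sum_nonneg fun k _ => sq_nonneg (v k))

/-- The continuous linear map `v ↦ M v` of a real square matrix. [folklore] -/
def soloInformedMatCLM (M : Matrix (Fin n) (Fin n) ℝ) : (Fin n → ℝ) →L[ℝ] (Fin n → ℝ) :=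
  LinearMap.toContinuousLinearMap (Matrix.toLin' M)

/-- Coordinates of `M v`. [folklore] -/
@[simp] theorem soloInformedMatCLM_apply (M : Matrix (Fin n) (Fin n) ℝ) (v : Fin n → ℝ)
    (j : Fin n) : soloInformedMatCLM M v j = ∑ k, M j k * v k := by
  simp [soloInformedMatCLM, Matrix.toLin'_apply, Matrix.mulVec, dotProduct]

/-- `det (v ↦ M v) = det M`. [folklore] -/
@[simp] theorem soloInformedMatCLM_det (M : Matrix (Fin n) (Fin n) ℝ) :
    (soloInformedMatCLM M).det = M.det := by
  simp [soloInformedMatCLM, ContinuousLinearMap.det]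

/-- **From the coordinatewise first-order Taylor clause to a derivative within the set** (sup
norm on `ℝⁿ`): if for every `ε > 0` some `δ > 0` gives
`(g x'_j - g x_j - (M (x' - x))_j)² ≤ ε² Σ_k (x'_k - x_k)²` for `x' ∈ A` with `|x' - x|_∞ < δ`,
then `g` has derivative `M` at `x` within `A`. [folklore] -/
theorem soloInformed_hasFDerivWithinAt_of_taylor {A : Set (Fin n → ℝ)}
    {g : (Fin n → ℝ) → Fin n → ℝ} {x : Fin n → ℝ} (M : Matrix (Fin n) (Fin n) ℝ)
    (h : ∀ e : ℝ, 0 < e → ∃ d : ℝ, 0 < d ∧ ∀ x' ∈ A, (∀ k, x' k - x k < d ∧ x k - x' k < d) →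
      ∀ j, (g x' j - g x j - ∑ k, M j k * (x' k - x k)) ^ 2 ≤ e ^ 2 * ∑ k, (x' k - x k) ^ 2) :
    HasFDerivWithinAt g (soloInformedMatCLM M) A x := by
  rw [hasFDerivWithinAt_iff_isLittleO, Asymptotics.isLittleO_iff]
  intro c hc
  rw [eventually_nhdsWithin_iff, Metric.eventually_nhds_iff]
  obtain ⟨d, hd, hT⟩ := h (c / (n + 1)) (by positivity)
  refine ⟨d, hd, fun x' hx'd hx'A => ?_⟩
  have hcl : ∀ k, x' k - x k < d ∧ x k - x' k < d := fun k => by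
    have hk : dist (x' k) (x k) < d := (dist_pi_lt_iff hd).1 hx'd k
    rw [Real.dist_eq] at hk
    exact abs_sub_lt_iff.1 hk
  refine (pi_norm_le_iff_of_nonneg (by positivity)).2 fun j => ?_
  have hcoord : (g x' - g x - soloInformedMatCLM M (x' - x)) j =
      g x' j - g x j - ∑ k, M j k * (x' k - x k) := by
    simp only [Pi.sub_apply, soloInformedMatCLM_apply]
  rw [Real.norm_eq_abs, hcoord]
  have hn : (c / (n + 1)) ^ 2 * ∑ k, (x' k - x k) ^ 2 ≤ (c * ‖x' - x‖) ^ 2 := by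
    have h1 : ∑ k, (x' k - x k) ^ 2 ≤ n * ‖x' - x‖ ^ 2 := by
      simpa only [Pi.sub_apply] using soloInformed_sum_sq_le (x' - x)
    have h2 : (n : ℝ) ≤ (n + 1) ^ 2 := by nlinarith [(Nat.cast_nonneg n : (0 : ℝ) ≤ n)]
    have hpos : (0 : ℝ) < (n + 1) ^ 2 := by positivity
    calc (c / (n + 1)) ^ 2 * ∑ k, (x' k - x k) ^ 2
        ≤ (c / (n + 1)) ^ 2 * (n * ‖x' - x‖ ^ 2) := mul_le_mul_of_nonneg_left h1 (sq_nonneg _)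
      _ = (c * ‖x' - x‖) ^ 2 * (n / (n + 1) ^ 2) := by rw [div_pow]; ring
      _ ≤ (c * ‖x' - x‖) ^ 2 * 1 :=
        mul_le_mul_of_nonneg_left ((div_le_one hpos).2 h2) (sq_nonneg _)
      _ = (c * ‖x' - x‖) ^ 2 := mul_one _
  exact abs_le_of_sq_le_sq ((hT x' hx'A hcl j).trans hn) (by positivity)

end Calculus

/-- Fibres `{x | (p, x) ∈ S}` of a `ℚ`-semialgebraic family over any parameter index are Lebesgue
measurable. [cite: BochnakCosteRoy1998, §2.2] -/
theorem soloInformed_measurableSet_fibre {K : Type*} {n : ℕ} {S : Set (K ⊕ Fin n → ℝ)}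
    (hS : IsSemialgebraic ℚ S) (p : K → ℝ) : MeasurableSet {x : Fin n → ℝ | Sum.elim p x ∈ S} := by
  have hm : Measurable fun x : Fin n → ℝ => (Sum.elim p x : K ⊕ Fin n → ℝ) := by
    refine measurable_pi_lambda _ fun t => ?_
    cases t with
    | inl l => simpa only [Sum.elim_inl] using measurable_const
    | inr s => simpa only [Sum.elim_inr] using measurable_pi_apply s
  exact hm (IsSemialgebraic.measurableSet_holds hS)

namespace SoloInformedTameMapShape

variable {K : Type*} {n N : ℕ} (σ : SoloInformedTameMapShape K n N)

/-- The `i`-th moving map at parameter `p`, read off the graph `G i(p)` (a junk value where the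
graph has no point over `x`). [folklore] -/
def move (i : Fin N) (p : K → ℝ) (x : Fin n → ℝ) : Fin n → ℝ :=
  Classical.epsilon fun y => σ.rel i p x y

/-- Where the graph has a point over `x`, `move` picks one. [folklore] -/
theorem rel_move {i : Fin N} {p : K → ℝ} {x : Fin n → ℝ} (h : ∃ y, σ.rel i p x y) :
    σ.rel i p x (σ.move i p x) :=
  Classical.epsilon_spec h

variable {D₀ : Set (Fin n → ℝ)} {p : K → ℝ}

/-- Under basic validity, `move i p` is the function with graph `G i(p)` on piece `i`.
[folklore] -/
theorem rel_iff_move_eq (hB : σ.BasicValid D₀ p) {i : Fin N} {x y : Fin n → ℝ}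
    (hx : x ∈ σ.piece i p) : σ.rel i p x y ↔ σ.move i p x = y := by
  obtain ⟨-, -, hex, huniq, -⟩ := σ.basicValid_iff.1 hB
  have hr : σ.rel i p x (σ.move i p x) := σ.rel_move (hex i x hx)
  exact ⟨fun h => huniq i x _ _ hx hr h, fun h => h ▸ hr⟩

/-- Under basic validity, `move i p` is injective on piece `i`. [folklore] -/
theorem injOn_move (hB : σ.BasicValid D₀ p) (i : Fin N) : InjOn (σ.move i p) (σ.piece i p) := by
  intro x hx x' hx' hxx'
  obtain ⟨-, -, -, -, -, -, hinj⟩ := σ.basicValid_iff.1 hB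
  exact (hinj i i x x' (σ.move i p x) hx hx' ((σ.rel_iff_move_eq hB hx).2 rfl)
    ((σ.rel_iff_move_eq hB hx').2 hxx'.symm)).2

/-- Under validity, `move i p` has, at every point of piece `i`, a derivative WITHIN the piece
of determinant `±1`. [folklore] -/
theorem exists_hasFDerivWithinAt_move (hV : σ.Valid D₀ p) (i : Fin N) :
    ∃ F : (Fin n → ℝ) → (Fin n → ℝ) →L[ℝ] (Fin n → ℝ),
      (∀ x ∈ σ.piece i p, HasFDerivWithinAt (σ.move i p) (F x) (σ.piece i p) x) ∧
      ∀ x ∈ σ.piece i p, |(F x).det| = 1 := by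
  have hdiff := σ.diffOK_iff.1 (hV.2 i)
  choose! ℓ hℓdet hℓT using hdiff
  refine ⟨fun x => soloInformedMatCLM (Matrix.of fun j k => ℓ x (j, k)), fun x hx => ?_,
    fun x hx => ?_⟩
  · apply soloInformed_hasFDerivWithinAt_of_taylor
    intro e he
    obtain ⟨d, hd, hT⟩ := hℓT x hx e he
    refine ⟨d, hd, fun x' hx' hcl j => ?_⟩
    have := hT x' (σ.move i p x) (σ.move i p x') hx' hcl ((σ.rel_iff_move_eq hV.1 hx).2 rfl)
      ((σ.rel_iff_move_eq hV.1 hx').2 rfl) j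
    simpa only [Matrix.of_apply] using this
  · rw [soloInformedMatCLM_det]
    exact soloInformed_abs_eq_one_of_sq_eq_one (hℓdet x hx)

/-- **Change of variables**: under validity the image of piece `i` under its moving map has
the same volume as the piece. [cite: EvansGariepy1992, §3.3] -/
theorem volume_image_move_piece {i : Fin N} (hS : IsSemialgebraic ℚ (σ.S i))
    (hV : σ.Valid D₀ p) : volume (σ.move i p '' σ.piece i p) = volume (σ.piece i p) := by
  obtain ⟨F, hF, hdet⟩ := σ.exists_hasFDerivWithinAt_move hV i
  have hmeas : MeasurableSet (σ.piece i p) := soloInformed_measurableSet_fibre hS p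
  rw [← lintegral_abs_det_fderiv_eq_addHaar_image volume hmeas hF (σ.injOn_move hV.1 i)]
  have hEq : EqOn (fun x => ENNReal.ofReal |(F x).det|) (fun _ => 1) (σ.piece i p) :=
    fun x hx => by simp only [hdet x hx, ENNReal.ofReal_one]
  rw [setLIntegral_congr_fun hmeas hEq]
  exact setLIntegral_one _

/-- Under validity the image of piece `i` under its moving map is measurable. [folklore] -/
theorem measurableSet_image_move_piece {i : Fin N} (hS : IsSemialgebraic ℚ (σ.S i))
    (hV : σ.Valid D₀ p) : MeasurableSet (σ.move i p '' σ.piece i p) := by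
  obtain ⟨F, hF, -⟩ := σ.exists_hasFDerivWithinAt_move hV i
  exact measurable_image_of_fderivWithin (soloInformed_measurableSet_fibre hS p) hF
    (σ.injOn_move hV.1 i)

/-- **SOUNDNESS, measure form**: `volume D₀ = ENNReal.ofReal (∏_j a_j(p))` for a valid parameter;
in particular the source of a valid nonlinear tame dissection has finite volume. [folklore] -/
theorem volume_eq_of_valid (hS : ∀ i, IsSemialgebraic ℚ (σ.S i)) (hV : σ.Valid D₀ p) :
    volume D₀ = ENNReal.ofReal (∏ j, σ.side p j) := by
  obtain ⟨hside, hpart, hex, huniq, hinto, honto, hinj⟩ := σ.basicValid_iff.1 hV.1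
  have hrel : ∀ i, ∀ x ∈ σ.piece i p, σ.rel i p x (σ.move i p x) := fun i x hx =>
    (σ.rel_iff_move_eq hV.1 hx).2 rfl
  have hcover : D₀ = ⋃ i, σ.piece i p := by
    ext x
    rw [mem_iUnion]
    exact (hpart x).1
  have hdisj : Pairwise (Function.onFun Disjoint fun i => σ.piece i p) := fun i i' hii' =>
    disjoint_left.2 fun x hxi hxi' => (hpart x).2 i i' hii' hxi hxi'
  have hcover' : soloInformedTameBox (σ.side p) = ⋃ i, σ.move i p '' σ.piece i p := by
    ext y
    rw [mem_iUnion]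
    constructor
    · intro hy
      obtain ⟨x, i, hx, hr⟩ := honto y hy
      exact ⟨i, x, hx, (σ.rel_iff_move_eq hV.1 hx).1 hr⟩
    · rintro ⟨i, x, hx, rfl⟩
      exact hinto i x _ hx (hrel i x hx)
  have hdisj' : Pairwise (Function.onFun Disjoint fun i => σ.move i p '' σ.piece i p) := by
    intro i i' hii'
    refine disjoint_left.2 fun y hy hy' => hii' ?_
    obtain ⟨x, hx, hxy⟩ := hy
    obtain ⟨x', hx', hx'y⟩ := hy'
    exact (hinj i i' x x' y hx hx' (hxy ▸ hrel i x hx) (hx'y ▸ hrel i' x' hx')).1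
  have hmeas : ∀ i, MeasurableSet (σ.piece i p) := fun i =>
    soloInformed_measurableSet_fibre (hS i) p
  have hmeas' : ∀ i, MeasurableSet (σ.move i p '' σ.piece i p) := fun i =>
    σ.measurableSet_image_move_piece (hS i) hV
  have h1 : volume D₀ = ∑ i, volume (σ.piece i p) := by
    rw [hcover, measure_iUnion hdisj hmeas, tsum_fintype]
  have h2 : volume (soloInformedTameBox (σ.side p)) = ∑ i, volume (σ.piece i p) := by
    rw [hcover', measure_iUnion hdisj' hmeas', tsum_fintype]
    exact Finset.sum_congr rfl fun i _ => σ.volume_image_move_piece (hS i) hV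
  have hbox : volume (soloInformedTameBox (σ.side p)) = ENNReal.ofReal (∏ j, σ.side p j) := by
    rw [soloInformedTameBox, volume_pi_pi]
    simp only [Real.volume_Icc, sub_zero]
    rw [ENNReal.ofReal_prod_of_nonneg fun j _ => hside j]
  rw [h1, ← h2, hbox]

/-- **SOUNDNESS.** If `p` is valid for the nonlinear shape `σ` (with `ℚ`-semialgebraic families
of pieces) and the source `D₀`, then the rational polynomial `∏_j Pa_j` evaluates at `p` to
`(volume D₀).toReal`. [folklore] -/
theorem aeval_prod_side_eq_volume_of_valid (hS : ∀ i, IsSemialgebraic ℚ (σ.S i))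
    (hV : σ.Valid D₀ p) : aeval p (∏ j, σ.Pa j) = (volume D₀).toReal := by
  have hside : ∀ j, 0 ≤ σ.side p j := (σ.basicValid_iff.1 hV.1).1
  have hprod : aeval p (∏ j, σ.Pa j) = ∏ j, σ.side p j := by
    rw [map_prod]
    rfl
  rw [hprod, σ.volume_eq_of_valid hS hV,
    ENNReal.toReal_ofReal (Finset.prod_nonneg fun j _ => hside j)]

end SoloInformedTameMapShape

end Summit.KontsevichZagierPeriods.KontsevichZagierPeriods.Theorems
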